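import Summits.Ventures.CertifiedQuantumChemistry.Rows.TempleLowerRow
import Summits.Ventures.CertifiedQuantumChemistry.Rows.LinearCombination
import Summits.Ventures.CertifiedQuantumChemistry.Rows.CISecondMoment
import Literature.MathematicalPhysics.QuantumLattice.GroundStateEnclosureCertificate
import HarnessLib

/-!
# Ventures/CertifiedQuantumChemistry — Rows/GapCertificateCodimOne.lean: the CODIMENSION-ONE gap
# certificate `GapCertificateCodimOne F a b σ` ("`λ₂(H_F | (a, b) sector) ≥ σ` counting multiplicity"),
# its downgrade to the spectral gap leg `GapCertificate` of `Rows/TempleLowerRow.lean`, and its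
# producers (form bound orthogonal to one vector; rank-one-shifted PSD form; LEVEL-SHIFT deflation
# from an ordinary lower row of a shifted table file)

HONEST FRAMING (verbatim): certified bounds for a stated model Hamiltonian in a stated basis; not a
claim about the real molecule or material beyond that model.

Typer chem-type-09 (LADDER-CHEM I-TYPE slot 09, cell chem-oracle; chem-lead B5-7 2026-08-26), REBASED on
chem-solver-6's `Rows/TempleLowerRow.lean` (p470245): there `GapCertificate F a b β` is the SPECTRAL gap
leg «every eigenvalue of `H_F` with a nonzero eigenvector in the `(a, b)` sector, other than the sector
ground energy, is `≥ β`» — exactly Temple's hypothesis, and enough for `lowerRow_of_temple`. It allows a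
DEGENERATE sector ground level. The a-posteriori EIGENVECTOR conclusions of the tree's Kato–Temple
apparatus (`TempleKato.sector_enclosure`: simplicity of the sector ground state, `sin ∠(ψ₀, w) ≤ r/(σ − ρ)`,
and hence certified intervals for ground-state EXPECTATIONS `⟨O⟩₀`, `TempleKato.abs_expect_sub_expect_le`)
need the stronger statement «`λ₂(H_F | sector) ≥ σ` COUNTING MULTIPLICITY», whose certificate shape is a
form bound on a subspace of codimension `≤ 1` in the sector. This file types that shape and shows that the
producers the cell has named conclude it at no extra cost.

## Contents (one `def`; everything else PROVED; nothing asserted about any file)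
* `GapCertificateCodimOne F a b σ` — there are a subspace `W` of the Fock space and a vector `u` with
  `Re⟨z, H_F z⟩ ≥ σ‖z‖²` on `W` and every `(a, b)`-sector vector in `W + ℂu`: the INPUT of
  `TempleKato.gap_of_codimOne_certificate` / `sector_enclosure` / `sector_enclosure_of_sums`
  (Courant–Fischer, two-dimensional step, Horn–Johnson Thm 4.2.6: = `λ₂(H_F|sector) ≥ σ`).
* `GapCertificateCodimOne.gapCertificate` — DOWNGRADE to p470245's spectral `GapCertificate F a b σ`
  (so `lowerRow_of_temple` applies unchanged: `lowerRow_of_temple_codimOne`); `GapCertificateCodimOne.mono`.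
* PRODUCERS (each concludes the strong form):
  `gapCertificateCodimOne_of_forall_orthogonal` — a form bound `σ‖x‖² ≤ Re⟨x, H_F x⟩` on the sector
  vectors orthogonal to ONE explicit `v` (chem-idea-1 2026-08-26T21:39:46Z (R1): the `hv` interface of
  `TempleKato.exists_codimOne_of_vector_certificate`);
  `gapCertificateCodimOne_of_posSemidef_rankOne` — the same relaxed by `+ c·|⟨φ, x⟩|²` ("`H_F − σ + c·φφ†`
  nonnegative as a FORM ON THE SECTOR", chem-solver-6 DESIGN diff-lambda §4 (β1); p470245's
  `gapCertificate_of_rankOne_shift` is this followed by the downgrade);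
  `gapCertificateCodimOne_of_lowerRow_shift` — the **LEVEL-SHIFT DEFLATION producer of record**
  (chem-idea-1 2026-08-26T21:40:54Z): an ORDINARY certified lower row `ℓ ≤ E₀(Ĥ(F + λ·S); a, b)` for the
  exact combined table file `Model.lincomb 1 λ F S` (`λ ≥ 0`; FORMAT-qcl1, readers A∧B — nothing new)
  plus a form bound `Re⟨x, Ĥ(S) x⟩ ≤ c‖x‖²` on the sector vectors orthogonal to an explicit `v` (for the
  occupation-weight deflator `S = F_w`, `v = |D⋆⟩`: chem-type-02's occupation-number lemma) gives
  `GapCertificateCodimOne F a b (ℓ − λc)` — «ONE kl1 certificate on a shifted FCIDUMP closes the gap leg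
  with no new reader code».
* BRIDGES: `lowerRow_of_temple_codimOne` (p470245's Temple row under the strong certificate);
  `CIVec.lowerRow_of_temple_gapCertificate` (chem-type-06's CI-record Temple row `Rows/CISecondMoment.lean`,
  whose hypothesis `hgap` is p470245's `GapCertificate` unfolded).

What is NOT here: Temple's inequality and its row (`Rows/TempleLowerRow.lean`, cited); β for any file;
the occupation-number analysis supplying the deflator bound (chem-type-02); the first-order DIFFERENCE
rows and `⟨O⟩` enclosures that consume `GapCertificateCodimOne` (`Rows/DifferenceSlopeRows.lean`); claim
nodes. References: Horn–Johnson (2013) Thm 4.2.6 (Courant–Fischer) [cite: HornJohnson2013, Thm 4.2.6];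
Reed–Simon IV Thm XIII.5 (Temple) [cite: ReedSimonIV1978, Thm XIII.5]; the tree's
`Literature/MathematicalPhysics/QuantumLattice/GroundStateEnclosureCertificate.lean` (Saad 1992 Ch. III §3.2).
-/

noncomputable section

namespace Summit.Ventures.CertifiedQuantumChemistry

open Matrix Finset
open Literature.MathematicalPhysics.QuantumLattice Literature.MathematicalPhysics.QuantumChemistry
open Literature.MathematicalPhysics.QuantumLattice.EigenvalueContinuation
open scoped ComplexOrder

variable {k : ℕ}

/-! ## §1 The codimension-one gap certificate and its downgrade to the spectral gap leg -/

/-- **CODIMENSION-ONE GAP CERTIFICATE** for the `(N_α, N_β) = (a, b)` sector of a model `F` at level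
`σ`: there are a subspace `W` of the Fock space and a vector `u` such that the form of `H_F` is
`≥ σ‖·‖²` on `W` and every vector of the `(a, b)` sector is `z + c•u` with `z ∈ W` (the sector meets `W`
in codimension `≤ 1`). By the two-dimensional Courant–Fischer step (Horn–Johnson Thm 4.2.6; the tree's
`TempleKato.gap_of_codimOne_certificate`) this says «`λ₂(H_F | sector) ≥ σ` counting multiplicity» and
it is the input of `TempleKato.sector_enclosure(_of_sums)`; it implies the spectral gap leg
`GapCertificate` of `Rows/TempleLowerRow.lean` and, when `E₀ < σ`, simplicity of the sector ground
state. In-house certificate object (director-chem P10 «THE CRUX IS β»; chem-lead B5-7).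
[cite: HornJohnson2013, Thm 4.2.6] -/
def GapCertificateCodimOne (F : Model k) (a b : ℕ) (σ : ℚ) : Prop :=
  ∃ (W : Submodule ℂ (Fock (Orb (Fin k)))) (u : Fock (Orb (Fin k))),
    (∀ z ∈ W, ((σ : ℚ) : ℝ) * (star z ⬝ᵥ z).re ≤ (star z ⬝ᵥ F.hamiltonian *ᵥ z).re) ∧
      ∀ x : Fock (Orb (Fin k)), IsInSector a b x → ∃ z ∈ W, ∃ c : ℂ, x = z + c • u

/-- A codimension-one gap certificate may be weakened downwards in `σ`. -/
theorem GapCertificateCodimOne.mono {F : Model k} {a b : ℕ} {σ σ' : ℚ}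
    (h : GapCertificateCodimOne F a b σ) (hle : σ' ≤ σ) : GapCertificateCodimOne F a b σ' := by
  obtain ⟨W, u, hW, hWK⟩ := h
  refine ⟨W, u, fun z hz => le_trans ?_ (hW z hz), hWK⟩
  exact mul_le_mul_of_nonneg_right (by exact_mod_cast hle) (re_star_dotProduct_self_nonneg z)

/-- The `(W, u)` data restated over the sector submodule `szSector (a + b) ((a − b)/2)` (the form the
tree's `TempleKato` theorems take). -/
theorem GapCertificateCodimOne.exists_codimOne {F : Model k} {a b : ℕ} {σ : ℚ}
    (h : GapCertificateCodimOne F a b σ) :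
    ∃ (W : Submodule ℂ (Fock (Orb (Fin k)))) (u : Fock (Orb (Fin k))),
      (∀ z ∈ W, ((σ : ℚ) : ℝ) * (star z ⬝ᵥ z).re ≤ (star z ⬝ᵥ F.hamiltonian *ᵥ z).re) ∧
        ∀ x ∈ (szSector (a + b) (((a : ℝ) - b) / 2) : Submodule ℂ (Fock (Orb (Fin k)))),
          ∃ z ∈ W, ∃ c : ℂ, x = z + c • u := by
  obtain ⟨W, u, hW, hWK⟩ := h
  exact ⟨W, u, hW, fun x hx => hWK x ((mem_szSector_iff_isInSector a b x).1 hx)⟩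

/-- **DOWNGRADE to the spectral gap leg.** `GapCertificateCodimOne F a b σ` (symmetric `F`) implies
`GapCertificate F a b σ` of `Rows/TempleLowerRow.lean`: every eigenvalue `e ≠ E₀(H_F; a, b)` of `H_F`
carried by a nonzero `(a, b)`-sector vector satisfies `σ ≤ e`. (If `E₀ < σ`: such an eigenvector is
orthogonal to a sector ground eigenvector, and on that hyperplane the certified form is `≥ σ` by
`TempleKato.gap_of_codimOne_certificate`; if `σ ≤ E₀`: every sector eigenvalue is `≥ E₀ ≥ σ` by the
variational principle.) Hence p470245's `lowerRow_of_temple` applies under the strong certificate.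
[cite: HornJohnson2013, Thm 4.2.6] -/
theorem GapCertificateCodimOne.gapCertificate {F : Model k} (hF : F.IsSymmetric) {a b : ℕ} {σ : ℚ}
    (hG : GapCertificateCodimOne F a b σ) : GapCertificate F a b σ := by
  intro e v hv hv0 hHv hne
  obtain ⟨W, u, hW, hWK⟩ := hG.exists_codimOne
  have hH : F.hamiltonian.IsHermitian := Model.hamiltonian_isHermitian hF
  set K : Submodule ℂ (Fock (Orb (Fin k))) := szSector (a + b) (((a : ℝ) - b) / 2) with hKdef
  have hE : F.energy a b = F.hamiltonian.minEnergyOn K := rfl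
  have hvK : v ∈ K := (mem_szSector_iff_isInSector a b v).2 hv
  have hvpos : 0 < (star v ⬝ᵥ v).re := re_star_dotProduct_self_pos hv0
  have hev : (star v ⬝ᵥ F.hamiltonian *ᵥ v).re = e * (star v ⬝ᵥ v).re :=
    re_star_dotProduct_mulVec_of_eigen hHv
  by_cases hσ : F.energy a b < ((σ : ℚ) : ℝ)
  · have hKH : ∀ x ∈ K, F.hamiltonian *ᵥ x ∈ K := fun x hx =>
      molecularHamiltonian_mulVec_mem_szSector _ _ _ hx
    have hKne : K ≠ ⊥ := fun h => hv0 ((Submodule.mem_bot ℂ).1 (h ▸ hvK))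
    obtain ⟨ψ, hψK, hψ1, hHψ⟩ := exists_unit_eigen_minEnergyOn hH K hKH hKne
    rw [← hE] at hHψ
    have horth : star ψ ⬝ᵥ v = 0 :=
      star_dotProduct_eq_zero_of_eigen hH.eq (Ne.symm hne) hHψ hHv
    have hgap := TempleKato.gap_of_codimOne_certificate hH.eq hW hWK hψK hψ1 hHψ hσ hvK horth
    rw [hev] at hgap
    exact le_of_mul_le_mul_right hgap hvpos
  · push Not at hσ
    have hE0 : F.energy a b * (star v ⬝ᵥ v).re ≤ (star v ⬝ᵥ F.hamiltonian *ᵥ v).re := by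
      rw [hE]
      exact minEnergyOn_mul_le_re_rayleigh hH K hvK
    rw [hev] at hE0
    exact hσ.trans (le_of_mul_le_mul_right hE0 hvpos)

/-! ## §2 Producers: how a certificate discharges the strong gap leg -/

/-- **From a form bound orthogonal to ONE explicit vector.** If for some explicit `v` (the integer CI
ground vector, or the dominant determinant `|D⋆⟩`) every `(a, b)`-sector vector `x` with `⟨v, x⟩ = 0`
has `σ‖x‖² ≤ Re⟨x, H_F x⟩`, then `GapCertificateCodimOne F a b σ` (`W = sector ∩ v^⊥`; the tree's
`TempleKato.exists_codimOne_of_vector_certificate`). This is the `hv` interface of chem-idea-1's (R1).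
[cite: HornJohnson2013, Thm 4.2.6] -/
theorem gapCertificateCodimOne_of_forall_orthogonal (F : Model k) {a b : ℕ} {σ : ℚ}
    (v : Fock (Orb (Fin k)))
    (h : ∀ x : Fock (Orb (Fin k)), IsInSector a b x → star v ⬝ᵥ x = 0 →
      ((σ : ℚ) : ℝ) * (star x ⬝ᵥ x).re ≤ (star x ⬝ᵥ F.hamiltonian *ᵥ x).re) :
    GapCertificateCodimOne F a b σ := by
  obtain ⟨W, u, hW, hWK⟩ := TempleKato.exists_codimOne_of_vector_certificate
    (A := F.hamiltonian) (szSector (a + b) (((a : ℝ) - b) / 2)) v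
    (fun x hx hvx => h x ((mem_szSector_iff_isInSector a b x).1 hx) hvx)
  exact ⟨W, u, hW, fun x hx => hWK x ((mem_szSector_iff_isInSector a b x).2 hx)⟩

/-- **From a rank-one-shifted PSD form on the sector** ("`H_F − σ·1 + c·|φ⟩⟨φ|` nonnegative as a
quadratic form on the `(a, b)` sector", the hypothesis of p470245's `gapCertificate_of_rankOne_shift`,
chem-solver-6 DESIGN diff-lambda §4 (β1)): the STRONG certificate follows (on `φ^⊥` the shift vanishes),
and p470245's spectral conclusion is its downgrade. Interlacing under a rank-one perturbation /
Courant–Fischer, Horn–Johnson Thm 4.2.6, §4.3. [cite: HornJohnson2013, Thm 4.2.6] -/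
theorem gapCertificateCodimOne_of_posSemidef_rankOne (F : Model k) {a b : ℕ} {σ : ℚ}
    (φ : Fock (Orb (Fin k))) (c : ℝ)
    (h : ∀ x : Fock (Orb (Fin k)), IsInSector a b x →
      ((σ : ℚ) : ℝ) * (star x ⬝ᵥ x).re ≤
        (star x ⬝ᵥ F.hamiltonian *ᵥ x).re + c * ‖star φ ⬝ᵥ x‖ ^ 2) :
    GapCertificateCodimOne F a b σ :=
  gapCertificateCodimOne_of_forall_orthogonal F φ fun x hx hφx => by
    have h' := h x hx
    rw [hφx, norm_zero, sq, mul_zero, mul_zero, add_zero] at h'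
    exact h'

/-- The Rayleigh quotient of the combined file `Ĥ(F + λ·S) = Ĥ(F) + λ·Ĥ(S)` splits accordingly
(`Model.hamiltonian_lincomb`). [folklore] -/
private theorem re_rayleigh_lincomb_one (lam : ℚ) (F S : Model k) (x : Fock (Orb (Fin k))) :
    (star x ⬝ᵥ (Model.lincomb 1 lam F S).hamiltonian *ᵥ x).re =
      (star x ⬝ᵥ F.hamiltonian *ᵥ x).re + (lam : ℝ) * (star x ⬝ᵥ S.hamiltonian *ᵥ x).re := by
  rw [Model.hamiltonian_lincomb, Rat.cast_one, one_smul, add_mulVec, smul_mulVec, dotProduct_add,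
    dotProduct_smul, smul_eq_mul, Complex.add_re, ← Complex.ofReal_ratCast, Complex.re_ofReal_mul]

/-- **THE LEVEL-SHIFT DEFLATION PRODUCER** (β-producer of record, chem-idea-1 2026-08-26T21:40:54Z).
For symmetric models `F`, `S` on the same `k` orbitals, a rational `λ ≥ 0`, an explicit vector `v` and
a rational `c` with `Re⟨x, Ĥ(S) x⟩ ≤ c‖x‖²` for every `(a, b)`-sector vector `x ⊥ v` (the deflator `S`
exceeds `c` only along `v`): an ORDINARY certified lower row `ℓ ≤ E₀(Ĥ(F + λS); a, b)` for the exact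
combined table file `Model.lincomb 1 λ F S` gives `GapCertificateCodimOne F a b (ℓ − λc)`. (For `x ⊥ v`
in the sector: `ℓ‖x‖² ≤ E₀‖x‖² ≤ Re⟨x, Ĥ(F)x⟩ + λRe⟨x, Ĥ(S)x⟩ ≤ Re⟨x, Ĥ(F)x⟩ + λc‖x‖²`.) With the
spin-free occupation weight `S = F_w`, `v = |D⋆⟩` and `c` from chem-type-02's occupation-number lemma,
ONE FORMAT-qcl1 certificate on the shifted file closes the gap leg — no new reader code; `ℓ(λ)` is concave
in `λ`, so a few values of `λ` bracket the best shift. [cite: HornJohnson2013, Thm 4.2.6] -/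
theorem gapCertificateCodimOne_of_lowerRow_shift {F S : Model k} (hF : F.IsSymmetric)
    (hS : S.IsSymmetric) {a b : ℕ} {lam : ℚ} (hlam : 0 ≤ lam) (v : Fock (Orb (Fin k))) {c : ℚ}
    (hSform : ∀ x : Fock (Orb (Fin k)), IsInSector a b x → star v ⬝ᵥ x = 0 →
      (star x ⬝ᵥ S.hamiltonian *ᵥ x).re ≤ ((c : ℚ) : ℝ) * (star x ⬝ᵥ x).re)
    {ℓ : ℚ} (hL : LowerRow (Model.lincomb 1 lam F S) a b ℓ) :
    GapCertificateCodimOne F a b (ℓ - lam * c) := by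
  refine gapCertificateCodimOne_of_forall_orthogonal F v fun x hx hvx => ?_
  have hx' : x ∈ szSector (a + b) (((a : ℝ) - b) / 2) := (mem_szSector_iff_isInSector a b x).2 hx
  have hvar := minEnergyOn_mul_le_re_rayleigh
    (Model.hamiltonian_isHermitian (Model.lincomb_isSymmetric (α := 1) (β := lam) hF hS)) _ hx'
  have hℓ := hL.le
  have hn : 0 ≤ (star x ⬝ᵥ x).re := re_star_dotProduct_self_nonneg x
  have h1 : ((ℓ : ℚ) : ℝ) * (star x ⬝ᵥ x).re ≤
      (star x ⬝ᵥ (Model.lincomb 1 lam F S).hamiltonian *ᵥ x).re :=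
    le_trans (mul_le_mul_of_nonneg_right hℓ hn) hvar
  rw [re_rayleigh_lincomb_one] at h1
  have h2 := mul_le_mul_of_nonneg_left (hSform x hx hvx) (show (0 : ℝ) ≤ lam by exact_mod_cast hlam)
  push_cast
  nlinarith

/-! ## §3 Bridges to the Temple rows already in the tree -/

/-- **Temple lower row under the strong certificate**: `GapCertificateCodimOne F a b β` and a
`TempleCertificate F a b lo β` (p470245: an explicit nonzero sector vector with exact moments
`A = Re⟨ψ, H_Fψ⟩`, `B = Re⟨ψ, H_F²ψ⟩`, `n = ⟨ψ, ψ⟩`, `A < βn`, `lo·(βn − A) ≤ βA − B`) give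
`LowerRow F a b lo` — p470245's `lowerRow_of_temple` after the downgrade. Reed–Simon IV Thm XIII.5 as
cited there. [cite: ReedSimonIV1978, Thm XIII.5] -/
theorem lowerRow_of_temple_codimOne {F : Model k} (hF : F.IsSymmetric) {a b : ℕ} {lo β : ℚ}
    (hG : GapCertificateCodimOne F a b β) (hT : TempleCertificate F a b lo β) : LowerRow F a b lo :=
  lowerRow_of_temple hF (hG.gapCertificate hF) hT

/-- **chem-type-06's CI-record Temple row with its gap leg supplied by the spectral gap leg of
p470245**: for a symmetric model, a CI record `ψ` with sector-pure determinants and `0 < normSq`,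
`GapCertificate F a b σ` (`Rows/TempleLowerRow.lean`) and `rayleighQuotient < σ`:
`LowerRow F a b (rayleighQuotient − variance/(σ − rayleighQuotient))` — the hypothesis `hgap` of
`CIVec.lowerRow_of_temple_gap` (`Rows/CISecondMoment.lean`) is `GapCertificate` unfolded; with
`GapCertificateCodimOne.gapCertificate` the strong certificate feeds it too. Weinstein–Stenger (1972)
Ch. 5 §9 eq. (2) as cited there. [cite: ReedSimonIV1978, Thm XIII.5] -/
theorem CIVec.lowerRow_of_temple_gapCertificate {n : ℕ} {F : Model k} (hF : F.IsSymmetric)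
    (ψ : CIVec k n) {a b : ℕ} (hsec : ψ.InSector a b) (hpos : 0 < ψ.normSq) {σ : ℚ}
    (hG : GapCertificate F a b σ) (hlt : ψ.rayleighQuotient F < σ) :
    LowerRow F a b (ψ.rayleighQuotient F - ψ.variance F / (σ - ψ.rayleighQuotient F)) :=
  CIVec.lowerRow_of_temple_gap hF ψ hsec hpos (fun e v hv hv0 hHv hne => hG e v hv hv0 hHv hne) hlt

/-! ## §4 The two-sided Temple bracket from one witness (appended 2026-08-26, chem-lead B6-3 (d)) -/

/-- **TWO-SIDED TEMPLE BRACKET from ONE explicit witness** (chem-lead B6-3 (d) «`bracket_of_temple`»):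
the spectral gap leg `GapCertificate F a b β` of `Rows/TempleLowerRow.lean` (supplied e.g. by
`GapCertificateCodimOne.gapCertificate` of a level-shift certificate, `Rows/LevelShiftGapRows.lean`), a
NONZERO vector `ψ` of the `(a, b)` sector with exact moments `A = Re⟨ψ, H_Fψ⟩`, `B = Re⟨ψ, H_F²ψ⟩`,
`n = ⟨ψ, ψ⟩` satisfying `A < β·n` and `lo·(β·n − A) ≤ β·A − B` (Temple's quotient; p470245
`lowerRow_of_temple`) and `A ≤ hi·n` (Rayleigh–Ritz; `upperRow_of_temple_witness`): `Bracket F a b lo hi` —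
both sides from ONE state, width at best `(B/n − (A/n)²)/(β − A/n)` = variance / gap margin, no
relaxation error. Reed–Simon IV Thm XIII.5 as cited there. [cite: ReedSimonIV1978, Thm XIII.5] -/
theorem bracket_of_temple_witness {F : Model k} (hF : F.IsSymmetric) {a b : ℕ} {lo hi β : ℚ}
    (hG : GapCertificate F a b β) {ψ : Fock (Orb (Fin k))} (hψ : IsInSector a b ψ) (hψ0 : ψ ≠ 0)
    (hlt : (star ψ ⬝ᵥ F.hamiltonian *ᵥ ψ).re < ((β : ℚ) : ℝ) * (star ψ ⬝ᵥ ψ).re)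
    (hle : ((lo : ℚ) : ℝ) * (((β : ℚ) : ℝ) * (star ψ ⬝ᵥ ψ).re - (star ψ ⬝ᵥ F.hamiltonian *ᵥ ψ).re) ≤
      ((β : ℚ) : ℝ) * (star ψ ⬝ᵥ F.hamiltonian *ᵥ ψ).re -
        (star ψ ⬝ᵥ (F.hamiltonian * F.hamiltonian) *ᵥ ψ).re)
    (hu : (star ψ ⬝ᵥ F.hamiltonian *ᵥ ψ).re ≤ ((hi : ℚ) : ℝ) * (star ψ ⬝ᵥ ψ).re) :
    Bracket F a b lo hi :=
  ⟨lowerRow_of_temple hF hG ⟨ψ, hψ, hψ0, hlt, hle⟩, upperRow_of_temple_witness hF hψ hψ0 hu⟩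

/-- The same bracket under the STRONG certificate `GapCertificateCodimOne F a b β` (downgrade first).
[cite: ReedSimonIV1978, Thm XIII.5] -/
theorem bracket_of_temple_witness_codimOne {F : Model k} (hF : F.IsSymmetric) {a b : ℕ}
    {lo hi β : ℚ} (hG : GapCertificateCodimOne F a b β) {ψ : Fock (Orb (Fin k))}
    (hψ : IsInSector a b ψ) (hψ0 : ψ ≠ 0)
    (hlt : (star ψ ⬝ᵥ F.hamiltonian *ᵥ ψ).re < ((β : ℚ) : ℝ) * (star ψ ⬝ᵥ ψ).re)
    (hle : ((lo : ℚ) : ℝ) * (((β : ℚ) : ℝ) * (star ψ ⬝ᵥ ψ).re - (star ψ ⬝ᵥ F.hamiltonian *ᵥ ψ).re) ≤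
      ((β : ℚ) : ℝ) * (star ψ ⬝ᵥ F.hamiltonian *ᵥ ψ).re -
        (star ψ ⬝ᵥ (F.hamiltonian * F.hamiltonian) *ᵥ ψ).re)
    (hu : (star ψ ⬝ᵥ F.hamiltonian *ᵥ ψ).re ≤ ((hi : ℚ) : ℝ) * (star ψ ⬝ᵥ ψ).re) :
    Bracket F a b lo hi :=
  bracket_of_temple_witness hF (hG.gapCertificate hF) hψ hψ0 hlt hle hu

end Summit.Ventures.CertifiedQuantumChemistry

end
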